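import Literature.Geometry.Riemannian.UnwindingRadialDerivative
import Literature.Geometry.Riemannian.UnwindingProfile
import Mathlib.Analysis.Calculus.Deriv.Slope
import HarnessLib

/-!
# Radial monotonicity of the interior surgery map: `∂_ρ R ≥ 1 - κ(C_χ + C_h)`

Topic `Geometry/Riemannian`. The radial function of the interior surgery map of Weinstein's disk
(Weinstein 1968, proof of the main theorem, step (3)) along the ray of a unit vector `u` is
`R_u(ρ) = ρ + χ(ρ) (‖C(clamp ρ · N u)‖ - clamp ρ)` with the step `χ` and the soft clamp of
`UnwindingProfile.lean` (`clamp = clamp_{ε₁}`) and the collar cone map `C`. Its derivative is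
`1 + χ'(ρ) d(clamp ρ, u) + χ(ρ) (g(clamp ρ, u) - 1) clamp'(ρ)` (`hasDerivAt_unwindingRadius`); with
`|χ'| ≤ C_χ`, `0 ≤ clamp' ≤ C_h`, the smallness `|d| ≤ κ` of the radial defect and the lower bound
`g ≥ 1 - κ` of the radial derivative on `|σ - 1| ≤ ε₁` (`UnwindingCollarData.lean`,
`UnwindingRadialDerivative.lean`) it is `≥ 1 - κ (C_χ + C_h)`, whence
**`(1 - κ(C_χ + C_h))(ρ' - ρ) ≤ R_u(ρ') - R_u(ρ)`** for `0 ≤ ρ ≤ ρ' ≤ 1 + ε₁`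
(`mul_sub_le_unwindingRadius_sub`) — hypothesis `hR` (radial part) of the shell lemma.

Also: the derivative `h' = smoothTransition + x · smoothTransition'` of `h(x) = x smoothTransition x`
is nonnegative and bounded (`hasDerivAt_mul_smoothTransition`, `deriv_mul_smoothTransition_nonneg`,
`exists_bound_deriv_mul_smoothTransition`), and `clamp' = h'((ρ - (1-ε))/(ε/2))`
(`hasDerivAt_clamp`).

## References

* A. Weinstein, Ann. of Math. (2) 87 (1968), 29–41. [cite: Weinstein1968]

Tags: [ConeMap] [Weinstein1968]
-/

noncomputable section

open Set Function Metric Filter Real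
open scoped Topology RealInnerProductSpace

namespace Literature.Geometry.Riemannian

/-! ### The derivative of `h(x) = x · smoothTransition x` and of the clamp -/

/-- `h' = smoothTransition + x · smoothTransition'`. [folklore] -/
theorem hasDerivAt_mul_smoothTransition (x : ℝ) :
    HasDerivAt (fun x : ℝ ↦ x * smoothTransition x)
      (smoothTransition x + x * deriv smoothTransition x) x := by
  have h1 : HasDerivAt smoothTransition (deriv smoothTransition x) x :=
    ((smoothTransition.contDiff (n := 1)).differentiable one_ne_zero).differentiableAt.hasDerivAt
  exact ((hasDerivAt_id x).mul h1).congr_deriv (by simp)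

/-- `0 ≤ h'(x)` (for `x < 0` the transition is locally `0`, so its derivative vanishes; for
`x ≥ 0` both terms are nonnegative). See also `Literature.Topology.FourManifolds.RadialStretch`
for `deriv smoothTransition x = 0`, `x < 0`. [folklore] -/
theorem deriv_mul_smoothTransition_nonneg (x : ℝ) :
    0 ≤ smoothTransition x + x * deriv smoothTransition x := by
  have h1 : 0 ≤ deriv smoothTransition x := smoothTransition.monotone.deriv_nonneg
  rcases lt_or_ge x 0 with hx | hx
  · have hev : smoothTransition =ᶠ[𝓝 x] fun _ ↦ (0 : ℝ) := by
      filter_upwards [Iio_mem_nhds hx] with y hy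
      exact smoothTransition.zero_of_nonpos (le_of_lt hy)
    rw [hev.deriv_eq, deriv_const, mul_zero, add_zero]
    exact smoothTransition.nonneg x
  · exact add_nonneg (smoothTransition.nonneg x) (mul_nonneg hx h1)

/-- **`h'` is bounded**: `|h'(x)| ≤ C_h` for all `x` (`h' = 0` on `x < 0`, `h' = 1` on `x > 1`,
continuous). [folklore] -/
theorem exists_bound_deriv_mul_smoothTransition :
    ∃ C : ℝ, 0 ≤ C ∧ ∀ x : ℝ, |smoothTransition x + x * deriv smoothTransition x| ≤ C := by
  have hcont : Continuous fun x : ℝ ↦ smoothTransition x + x * deriv smoothTransition x :=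
    smoothTransition.continuous.add
      (continuous_id.mul ((smoothTransition.contDiff (n := 1)).continuous_deriv le_rfl))
  obtain ⟨C, hC⟩ := (isCompact_Icc (a := (-1 : ℝ)) (b := 2)).exists_bound_of_continuousOn
    hcont.continuousOn
  refine ⟨max C 1, le_max_of_le_right zero_le_one, fun x ↦ ?_⟩
  by_cases hx : x ∈ Icc (-1 : ℝ) 2
  · exact ((Real.norm_eq_abs _).symm.le.trans (hC x hx)).trans (le_max_left _ _)
  · rw [mem_Icc, not_and_or, not_le, not_le] at hx
    rcases hx with hx | hx
    · have hev : smoothTransition =ᶠ[𝓝 x] fun _ ↦ (0 : ℝ) := by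
        filter_upwards [Iio_mem_nhds (show x < 0 by linarith)] with y hy
        exact smoothTransition.zero_of_nonpos (le_of_lt hy)
      rw [hev.deriv_eq, deriv_const, mul_zero, add_zero,
        smoothTransition.zero_of_nonpos (by linarith), abs_zero]
      exact le_trans zero_le_one (le_max_right _ _)
    · -- `h = id` near `x > 1`
      have hev : (fun y : ℝ ↦ y * smoothTransition y) =ᶠ[𝓝 x] fun y ↦ y := by
        filter_upwards [Ioi_mem_nhds (show (1 : ℝ) < x by linarith)] with y hy
        exact mul_smoothTransition_of_one_le (le_of_lt hy)
      have hd : smoothTransition x + x * deriv smoothTransition x = 1 := by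
        rw [← (hasDerivAt_mul_smoothTransition x).deriv, hev.deriv_eq, deriv_id'']
      rw [hd, abs_one]
      exact le_max_right _ _

/-- **`clamp_ε' (ρ) = h'((ρ - (1-ε))/(ε/2))`.** [folklore] -/
theorem hasDerivAt_clamp {ε : ℝ} (hε : 0 < ε) (ρ : ℝ) :
    HasDerivAt (fun ρ : ℝ ↦
        (1 - ε) + ε / 2 * ((ρ - (1 - ε)) / (ε / 2) * smoothTransition ((ρ - (1 - ε)) / (ε / 2))))
      (smoothTransition ((ρ - (1 - ε)) / (ε / 2)) +
        (ρ - (1 - ε)) / (ε / 2) * deriv smoothTransition ((ρ - (1 - ε)) / (ε / 2))) ρ := by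
  have hε2 : (ε / 2) ≠ 0 := by positivity
  have hlin : HasDerivAt (fun ρ : ℝ ↦ (ρ - (1 - ε)) / (ε / 2)) (1 / (ε / 2)) ρ := by
    simpa using ((hasDerivAt_id ρ).sub_const (1 - ε)).div_const (ε / 2)
  have hh := (hasDerivAt_mul_smoothTransition ((ρ - (1 - ε)) / (ε / 2))).comp ρ hlin
  have h := (hh.const_mul (ε / 2)).const_add (1 - ε)
  exact h.congr_deriv (by field_simp)

/-! ### The radial function of the surgery map along a ray -/

variable {V : Type*} [NormedAddCommGroup V] [InnerProductSpace ℝ V]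

/-- **The derivative of `R_u(ρ) = ρ + χ(ρ)(‖C(clamp ρ · N u)‖ - clamp ρ)`.** [folklore] -/
theorem hasDerivAt_unwindingRadius {C : V → V} {ε' ε₁ : ℝ} (hε₁ : 0 < ε₁) (hε₁ε : ε₁ < ε')
    (hε'1 : ε' < 1) (hC : DifferentiableOn ℝ C {v : V | 1 - ε' < ‖v‖ ∧ ‖v‖ < 1 + ε'})
    (hC0 : ∀ v : V, 1 - ε' < ‖v‖ → ‖v‖ < 1 + ε' → C v ≠ 0) {u : V} (hu : u ≠ 0) {ρ : ℝ}
    (hρ : ρ < 1 + ε') :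
    HasDerivAt (fun ρ : ℝ ↦ ρ + smoothTransition (3 * ρ - 1) *
        (‖C (((1 - ε₁) + ε₁ / 2 * ((ρ - (1 - ε₁)) / (ε₁ / 2) *
            smoothTransition ((ρ - (1 - ε₁)) / (ε₁ / 2)))) • (‖u‖⁻¹ • u))‖ -
          ((1 - ε₁) + ε₁ / 2 * ((ρ - (1 - ε₁)) / (ε₁ / 2) *
            smoothTransition ((ρ - (1 - ε₁)) / (ε₁ / 2))))))
      (1 + (deriv (fun ρ : ℝ ↦ smoothTransition (3 * ρ - 1)) ρ *
          (‖C (((1 - ε₁) + ε₁ / 2 * ((ρ - (1 - ε₁)) / (ε₁ / 2) *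
              smoothTransition ((ρ - (1 - ε₁)) / (ε₁ / 2)))) • (‖u‖⁻¹ • u))‖ -
            ((1 - ε₁) + ε₁ / 2 * ((ρ - (1 - ε₁)) / (ε₁ / 2) *
              smoothTransition ((ρ - (1 - ε₁)) / (ε₁ / 2))))) +
        smoothTransition (3 * ρ - 1) *
          ((⟪‖C (((1 - ε₁) + ε₁ / 2 * ((ρ - (1 - ε₁)) / (ε₁ / 2) *
                smoothTransition ((ρ - (1 - ε₁)) / (ε₁ / 2)))) • (‖u‖⁻¹ • u))‖⁻¹ •
              C (((1 - ε₁) + ε₁ / 2 * ((ρ - (1 - ε₁)) / (ε₁ / 2) *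
                smoothTransition ((ρ - (1 - ε₁)) / (ε₁ / 2)))) • (‖u‖⁻¹ • u)),
            fderiv ℝ C (((1 - ε₁) + ε₁ / 2 * ((ρ - (1 - ε₁)) / (ε₁ / 2) *
                smoothTransition ((ρ - (1 - ε₁)) / (ε₁ / 2)))) • (‖u‖⁻¹ • u)) (‖u‖⁻¹ • u)⟫ - 1) *
            (smoothTransition ((ρ - (1 - ε₁)) / (ε₁ / 2)) +
              (ρ - (1 - ε₁)) / (ε₁ / 2) * deriv smoothTransition ((ρ - (1 - ε₁)) / (ε₁ / 2)))))) ρ := by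
  -- abbreviations
  set cl : ℝ → ℝ := fun ρ ↦ (1 - ε₁) + ε₁ / 2 * ((ρ - (1 - ε₁)) / (ε₁ / 2) *
    smoothTransition ((ρ - (1 - ε₁)) / (ε₁ / 2))) with hcl
  set cl' : ℝ := smoothTransition ((ρ - (1 - ε₁)) / (ε₁ / 2)) +
    (ρ - (1 - ε₁)) / (ε₁ / 2) * deriv smoothTransition ((ρ - (1 - ε₁)) / (ε₁ / 2)) with hcl'
  set r : ℝ → ℝ := fun s ↦ ‖C (s • (‖u‖⁻¹ • u))‖ with hr
  set g : ℝ := ⟪‖C (cl ρ • (‖u‖⁻¹ • u))‖⁻¹ • C (cl ρ • (‖u‖⁻¹ • u)),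
    fderiv ℝ C (cl ρ • (‖u‖⁻¹ • u)) (‖u‖⁻¹ • u)⟫ with hg
  set χ : ℝ → ℝ := fun ρ ↦ smoothTransition (3 * ρ - 1) with hχ
  -- the clamp value is in the collar
  have hclmem : |cl ρ - 1| < ε' := by
    have h1 : 1 - ε₁ ≤ cl ρ := le_clamp hε₁ ρ
    have h2 : cl ρ ≤ max ρ (1 - ε₁) := by
      rcases le_or_gt (1 - ε₁) ρ with h | h
      · exact (clamp_le_self hε₁ h).trans (le_max_left _ _)
      · rw [show cl ρ = 1 - ε₁ from clamp_of_le hε₁ h.le]; exact le_max_right _ _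
    rw [abs_lt]
    constructor
    · linarith
    · have : max ρ (1 - ε₁) < 1 + ε' := max_lt hρ (by linarith)
      linarith
  -- derivatives of the pieces
  have hclder : HasDerivAt cl cl' ρ := hasDerivAt_clamp hε₁ ρ
  have hrder : HasDerivAt r g (cl ρ) := hasDerivAt_norm_coneMap_ray hε'1 hC hC0 hclmem hu
  have hχder : HasDerivAt χ (deriv χ ρ) ρ :=
    ((contDiff_chi (n := 1)).differentiable one_ne_zero).differentiableAt.hasDerivAt
  -- `ρ ↦ r (cl ρ) - cl ρ`
  have hd : HasDerivAt (fun ρ ↦ r (cl ρ) - cl ρ) (g * cl' - cl') ρ :=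
    (hrder.comp ρ hclder).sub hclder
  have hprod := hχder.mul hd
  have htot := (hasDerivAt_id ρ).add hprod
  have e : (fun ρ : ℝ ↦ ρ + smoothTransition (3 * ρ - 1) *
        (‖C (((1 - ε₁) + ε₁ / 2 * ((ρ - (1 - ε₁)) / (ε₁ / 2) *
            smoothTransition ((ρ - (1 - ε₁)) / (ε₁ / 2)))) • (‖u‖⁻¹ • u))‖ -
          ((1 - ε₁) + ε₁ / 2 * ((ρ - (1 - ε₁)) / (ε₁ / 2) *
            smoothTransition ((ρ - (1 - ε₁)) / (ε₁ / 2)))))) =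
      fun x : ℝ ↦ id x + χ x * (r (cl x) - cl x) := by
    funext s; rfl
  rw [e]
  exact htot.congr_deriv (by ring)

/-- **Radial monotonicity**: with `|χ'| ≤ C_χ`, `0 ≤ h' ≤ C_h`, `|d(σ, u)| ≤ κ` and
`g(σ, u) ≥ 1 - κ` for `|σ - 1| ≤ ε₁`, the radial function satisfies
`(1 - κ(C_χ + C_h))(ρ' - ρ) ≤ R_u(ρ') - R_u(ρ)` for `0 ≤ ρ ≤ ρ' ≤ 1 + ε₁`.
[cite: Weinstein1968, proof of the main theorem, step (3)] -/
theorem mul_sub_le_unwindingRadius_sub {C : V → V} {ε' ε₁ : ℝ} (hε₁ : 0 < ε₁) (hε₁ε : ε₁ < ε')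
    (hε'1 : ε' < 1) (hC : DifferentiableOn ℝ C {v : V | 1 - ε' < ‖v‖ ∧ ‖v‖ < 1 + ε'})
    (hC0 : ∀ v : V, 1 - ε' < ‖v‖ → ‖v‖ < 1 + ε' → C v ≠ 0) {u : V} (hu : u ≠ 0) {κ Cχ Ch : ℝ}
    (hκ : 0 ≤ κ)
    (hχ : ∀ ρ, |deriv (fun ρ : ℝ ↦ smoothTransition (3 * ρ - 1)) ρ| ≤ Cχ)
    (hh : ∀ x, |smoothTransition x + x * deriv smoothTransition x| ≤ Ch)
    (hd : ∀ σ : ℝ, |σ - 1| ≤ ε₁ → |‖C (σ • (‖u‖⁻¹ • u))‖ - σ| ≤ κ)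
    (hg : ∀ σ : ℝ, |σ - 1| ≤ ε₁ →
      1 - κ ≤ ⟪‖C (σ • (‖u‖⁻¹ • u))‖⁻¹ • C (σ • (‖u‖⁻¹ • u)),
        fderiv ℝ C (σ • (‖u‖⁻¹ • u)) (‖u‖⁻¹ • u)⟫)
    {ρ ρ' : ℝ} (hρ0 : 0 ≤ ρ) (hρρ' : ρ ≤ ρ') (hρ' : ρ' ≤ 1 + ε₁) :
    (1 - κ * (Cχ + Ch)) * (ρ' - ρ) ≤
      (ρ' + smoothTransition (3 * ρ' - 1) *
        (‖C (((1 - ε₁) + ε₁ / 2 * ((ρ' - (1 - ε₁)) / (ε₁ / 2) *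
            smoothTransition ((ρ' - (1 - ε₁)) / (ε₁ / 2)))) • (‖u‖⁻¹ • u))‖ -
          ((1 - ε₁) + ε₁ / 2 * ((ρ' - (1 - ε₁)) / (ε₁ / 2) *
            smoothTransition ((ρ' - (1 - ε₁)) / (ε₁ / 2)))))) -
      (ρ + smoothTransition (3 * ρ - 1) *
        (‖C (((1 - ε₁) + ε₁ / 2 * ((ρ - (1 - ε₁)) / (ε₁ / 2) *
            smoothTransition ((ρ - (1 - ε₁)) / (ε₁ / 2)))) • (‖u‖⁻¹ • u))‖ -
          ((1 - ε₁) + ε₁ / 2 * ((ρ - (1 - ε₁)) / (ε₁ / 2) *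
            smoothTransition ((ρ - (1 - ε₁)) / (ε₁ / 2)))))) := by
  set cl : ℝ → ℝ := fun ρ ↦ (1 - ε₁) + ε₁ / 2 * ((ρ - (1 - ε₁)) / (ε₁ / 2) *
    smoothTransition ((ρ - (1 - ε₁)) / (ε₁ / 2))) with hcl
  set Rf : ℝ → ℝ := fun ρ ↦ ρ + smoothTransition (3 * ρ - 1) *
    (‖C (cl ρ • (‖u‖⁻¹ • u))‖ - cl ρ) with hRf
  show (1 - κ * (Cχ + Ch)) * (ρ' - ρ) ≤ Rf ρ' - Rf ρ
  -- the derivative and its lower bound on `D = Icc 0 (1 + ε₁)`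
  have hkey : ∀ s ∈ Icc (0 : ℝ) (1 + ε₁), ∃ D' : ℝ, HasDerivAt Rf D' s ∧ 1 - κ * (Cχ + Ch) ≤ D' := by
    intro s hs
    have hs' : s < 1 + ε' := by linarith [hs.2]
    refine ⟨_, hasDerivAt_unwindingRadius hε₁ hε₁ε hε'1 hC hC0 hu hs', ?_⟩
    -- the clamp value satisfies `|cl s - 1| ≤ ε₁`
    have hcl1 : |cl s - 1| ≤ ε₁ := by
      have h1 : 1 - ε₁ ≤ cl s := le_clamp hε₁ s
      have h2 : cl s ≤ max s (1 - ε₁) := by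
        rcases le_or_gt (1 - ε₁) s with h | h
        · exact (clamp_le_self hε₁ h).trans (le_max_left _ _)
        · rw [show cl s = 1 - ε₁ from clamp_of_le hε₁ h.le]; exact le_max_right _ _
      rw [abs_le]; constructor
      · linarith
      · have : max s (1 - ε₁) ≤ 1 + ε₁ := max_le hs.2 (by linarith); linarith
    have hds := hd (cl s) hcl1
    have hgs := hg (cl s) hcl1
    have hχs := hχ s
    have hhs := hh ((s - (1 - ε₁)) / (ε₁ / 2))
    have hχ01 : 0 ≤ smoothTransition (3 * s - 1) ∧ smoothTransition (3 * s - 1) ≤ 1 :=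
      ⟨smoothTransition.nonneg _, smoothTransition.le_one _⟩
    have hh0 := deriv_mul_smoothTransition_nonneg ((s - (1 - ε₁)) / (ε₁ / 2))
    -- abbreviate the three scalars
    set dval : ℝ := ‖C (cl s • (‖u‖⁻¹ • u))‖ - cl s with hdval
    set gval : ℝ := ⟪‖C (cl s • (‖u‖⁻¹ • u))‖⁻¹ • C (cl s • (‖u‖⁻¹ • u)),
      fderiv ℝ C (cl s • (‖u‖⁻¹ • u)) (‖u‖⁻¹ • u)⟫ with hgval
    set hval : ℝ := smoothTransition ((s - (1 - ε₁)) / (ε₁ / 2)) +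
      (s - (1 - ε₁)) / (ε₁ / 2) * deriv smoothTransition ((s - (1 - ε₁)) / (ε₁ / 2)) with hhval
    set χ' : ℝ := deriv (fun ρ : ℝ ↦ smoothTransition (3 * ρ - 1)) s with hχ'
    set χv : ℝ := smoothTransition (3 * s - 1) with hχv
    show 1 - κ * (Cχ + Ch) ≤ 1 + (χ' * dval + χv * ((gval - 1) * hval))
    -- `χ' dval ≥ -Cχ κ` and `χv (gval - 1) hval ≥ -κ Ch`
    have h1 : -(Cχ * κ) ≤ χ' * dval := by
      have := abs_le.1 (abs_mul χ' dval ▸ (mul_le_mul (hχs) (hds) (abs_nonneg _)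
        ((abs_nonneg _).trans hχs)) : |χ' * dval| ≤ Cχ * κ)
      linarith [this.1]
    have h2 : -(κ * Ch) ≤ χv * ((gval - 1) * hval) := by
      have hg1 : -κ ≤ gval - 1 := by linarith
      have hhle : hval ≤ Ch := (le_abs_self _).trans hhs
      -- `(gval - 1) * hval ≥ -κ * Ch`
      have h3 : -(κ * Ch) ≤ (gval - 1) * hval := by nlinarith
      -- multiply by `χv ∈ [0, 1]`
      nlinarith [hχ01.1, hχ01.2, mul_nonneg hκ ((abs_nonneg _).trans hhs)]
    nlinarith
  have hconv : Convex ℝ (Icc (0 : ℝ) (1 + ε₁)) := convex_Icc _ _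
  have hcont : ContinuousOn Rf (Icc (0 : ℝ) (1 + ε₁)) := fun s hs ↦ by
    obtain ⟨D', hD', -⟩ := hkey s hs
    exact hD'.continuousAt.continuousWithinAt
  have hdiff : DifferentiableOn ℝ Rf (interior (Icc (0 : ℝ) (1 + ε₁))) := fun s hs ↦ by
    obtain ⟨D', hD', -⟩ := hkey s (interior_subset hs)
    exact hD'.differentiableAt.differentiableWithinAt
  have hge : ∀ s ∈ interior (Icc (0 : ℝ) (1 + ε₁)), 1 - κ * (Cχ + Ch) ≤ deriv Rf s := by
    intro s hs
    obtain ⟨D', hD', hle⟩ := hkey s (interior_subset hs)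
    rw [hD'.deriv]; exact hle
  exact hconv.mul_sub_le_image_sub_of_le_deriv hcont hdiff hge ρ ⟨hρ0, hρρ'.trans hρ'⟩ ρ'
    ⟨hρ0.trans hρρ', hρ'⟩ hρρ'

end Literature.Geometry.Riemannian

end
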